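import Summits.QuantumFields.BalabanUV.Beta.EriceFlowEnclosureInverseLawModulus

/-!
# Beta / EriceFlowEnclosureInverseLawFunction — INVERSION CARRYING A FUNCTION TERM (pure SERVICE; the third member of the lineage's
# inversion family P2 #36c `…InverseLawThird` ∕ P2 #46b `…InverseLawModulus`).  Let `D t := Λ t − 1∕t − κ·log t − C` be the DEVIATION
# of Λ from its two-loop normal form, `|D t| ≤ M·t` on ]0, t₁[, and σ an eventual right inverse of Λ with `σ y → 0⁺`, `y·σ y → 1`.  Then
#        **eventually |1∕σ y − y − κ·log y + C − κ²·(log y)∕y + κC∕y + D(σ y)| ≤ A·(1 + log y)²∕y²**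
# — THE INVERSE READS THE DEVIATION AT ITS OWN POINT, EXACTLY TO O((log y)²∕y²), with NO hypothesis on the SHAPE of D (`inverse_law_deviation`;
# also `|σ y − 1∕y| ≤ 2B(1 + log y)∕y²`); if D = F + (error ≤ t·ω(t), ω monotone) with F M-LIPSCHITZ, the deviation may be read at 1∕y instead:
#        **eventually |1∕σ y − y − κ·log y + C − κ²·(log y)∕y + κC∕y + F(1∕y)| ≤ A′·(1 + log y)²∕y² + 2·ω(2∕y)∕y**
# (`inverse_law_function`; F = a·t is P2 #46b `inverse_law_modulus`), and with ω → 0 at 0⁺ THE 1∕y LETTER OF THE INVERSE IS THE SLOPE OF F AT 0⁺: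
#        **for every b:  y·(1∕σ y − y − κ·log y + C − κ²(log y)∕y + (κC + b)∕y) → 0   ⟺   F(t)∕t → b at 0⁺**
# (`invY_letter_iff_slope`) — consumed by P2 #50b (the continuum running coupling carries the three-loop Cesàro datum EXACTLY, F = −κ²t −
# (1∕|β₀|)∫₀ᵗ r∕u², NO clause) and P2 #50c (the Markov road under (SV))
# (β-flow team, prover 2 = lower ∕ positivity side, unit `b2b-balaban-beta-bflow-p2`, gen 33; module P2 #50a over P2 #36c's exact rearrangement
# `inverse_third_identity` ∕ four-term bound `inverse_third_remainder_le` (a-slot and E₃-slot set to zero) ∕ `abs_log_sub_le_of_inv_eq` and P2 #44-A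
# `logSq_div_sq_le_inv_sqrt`, all BY NAME through P2 #46b)

HONEST FRAMING (page 1 of everything the β sub-cell writes): discharging `BetaPertH` makes Bałaban's UV stability UNCONDITIONAL — a
real constructive-QFT result; it is NOT the continuum limit and NOT the Clay problem.  HONEST DEPENDENCY (cell reorg 2026-08-19,
verbatim): «continuum YM on T⁴ ⇐ BetaPertH ∧ nine spine estimates (0/9 proved); BetaPertH ⇐ (D1) ∧ (D4) ∧ CAP+tail; G-an2-4 gates
asym, D1 and NE2/3/4.»  THIS MODULE DISCHARGES NOTHING and quotes nothing: [folklore] real analysis about real functions Λ, σ, F, ω and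
real letters κ, C, M, b; no Erice sentence occurs (the consumers supply the Λ-laws).

THE POINT.  At t = σ y (so Λ t = y): E := y − 1∕t − κ log t − C IS the deviation D(t) — no letter is split off.  P2 #36c's exact rearrangement
with its a-slot := 0 and E₃ := E reads `1∕t − y − κ log y + C − κ²(log y)∕y + κC∕y = −κ²(u + r)∕y − κE∕y − κr − E` (u := (C + κ log t + E)∕y,
`1∕(yt) = 1 − u`, `log(yt) = u + r`, |r| ≤ 2u²), so `… + D(t)` is the THREE-term part, ≤ A·L²∕y² by `inverse_third_remainder_le` (|E| ≤ M t ≤ 2M∕y,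
|u| ≤ BL∕y, B = |C| + |κ| + 2M, L = 1 + log y).  Transport: `t − 1∕y = t·u`, so |σ y − 1∕y| ≤ 2BL∕y² and an M-Lipschitz F moves from σ y to 1∕y at
cost 2MBL∕y²; the error part of D rides as `|e(t)| ≤ t·ω(t) ≤ (2∕y)·ω(2∕y)` (ω monotone — the one place monotonicity is used).  Letters: the
majorant is o(1∕y) when ω → 0, and `y·F(1∕y) → b ⟺ F(t)∕t → b` is the substitution t = 1∕y (`tendsto_mul_comp_inv_iff`).

WHAT THIS FILE PROVES (0 sorry, 0 def): §0 `tendsto_mul_comp_inv_iff`; §1 HEADLINE **`inverse_law_deviation`** (with the companion bound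
`|σ y − 1∕y| ≤ 2B(1 + log y)∕y²`; A = κ²B + κ²B² + 2M|κ| + 2|κ|B² DISPLAYED); §2 **`inverse_law_function`** (A′ = A + 2MB for the Lipschitz reading,
M replaced by M + ω(t₁∕2) inside B); §3 `inverse_law_function_littleO`, **`invY_letter_iff_slope`**, `invY_letter_of_slope`.
NOT CLAIMED: the Λ-law itself (a HYPOTHESIS here); anything about (1.22); `BetaPertH`; continuum; Clay.
-/

namespace Summit.QuantumFields.BalabanUV.Beta.EriceFlowEnclosureInverseLawFunction

open Set Filter Topology
open Summit.QuantumFields.BalabanUV.Beta.EriceFlowEnclosureInverseLawThird (abs_log_sub_le_of_inv_eq inverse_third_identity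
  inverse_third_remainder_le)
open Summit.QuantumFields.BalabanUV.Beta.EriceFlowEnclosureModulusTails (logSq_div_sq_le_inv_sqrt)

noncomputable section

/-! ## §0 The substitution t = 1∕y -/

/-- **The substitution t = 1∕y** ([folklore]): `y·F(1∕y)` has the limit l as y → ∞ iff `F(t)∕t` has the limit l as t → 0⁺
(`y ↦ 1∕y` maps `atTop` to `𝓝[>] 0` and `t ↦ 1∕t` maps back; `(1∕t)·F(1∕(1∕t)) = F(t)∕t`). -/
theorem tendsto_mul_comp_inv_iff {F : ℝ → ℝ} {l : Filter ℝ} :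
    Tendsto (fun y => y * F (1 / y)) atTop l ↔ Tendsto (fun t => F t / t) (𝓝[>] 0) l := by
  constructor
  · intro h
    refine (h.comp tendsto_inv_nhdsGT_zero).congr' ?_
    refine Eventually.of_forall fun t => ?_
    simp only [Function.comp_def, one_div, inv_inv]
    rw [div_eq_inv_mul]
  · intro h
    refine (h.comp tendsto_inv_atTop_nhdsGT_zero).congr' ?_
    refine Eventually.of_forall fun y => ?_
    simp only [Function.comp_def, one_div]
    rw [div_eq_mul_inv, inv_inv, mul_comm]

/-! ## §1 The inverse reads the deviation at its own point -/

/-- **INVERSION READING THE DEVIATION AT ITS OWN POINT (HEADLINE; pure real analysis).**  If `|Λ t − 1∕t − κ·log t − C| ≤ M·t` on ]0, t₁[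
(t₁ > 0, M ≥ 0), σ is an eventual right inverse of Λ with `σ y → 0⁺` and `y·σ y → 1`, then eventually BOTH
`|1∕σ y − y − κ·log y + C − κ²·(log y)∕y + κC∕y + (Λ(σ y) − 1∕σ y − κ·log(σ y) − C)| ≤ A·(1 + log y)²∕y²`,
A = κ²B + κ²B² + |κ|·2M + 2|κ|B², B = |C| + |κ| + 2M, AND `|σ y − 1∕y| ≤ 2B·(1 + log y)∕y²` — the inverse reads Λ's deviation from
its two-loop normal form AT THE POINT σ y, with no hypothesis on the deviation's shape (P2 #36c's `inverse_third_identity` with the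
a-slot 0 and the E₃-slot the whole deviation; `inverse_third_remainder_le`). [folklore] -/
theorem inverse_law_deviation {Λ σ : ℝ → ℝ} {κ C M t₁ : ℝ} (hM : 0 ≤ M)
    (hdev : ∀ t ∈ Ioo 0 t₁, |Λ t - 1 / t - κ * Real.log t - C| ≤ M * t)
    (hσ0 : Tendsto σ atTop (𝓝[>] 0)) (hσ : ∀ᶠ y in atTop, Λ (σ y) = y)
    (hone : Tendsto (fun y => y * σ y) atTop (𝓝 1)) (ht₁ : 0 < t₁) :
    ∀ᶠ y in atTop,
      |1 / σ y - y - κ * Real.log y + C - κ ^ 2 * Real.log y / y + κ * C / y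
          + (Λ (σ y) - 1 / σ y - κ * Real.log (σ y) - C)|
        ≤ (κ ^ 2 * (|C| + |κ| + 2 * M) + κ ^ 2 * (|C| + |κ| + 2 * M) ^ 2 + |κ| * (2 * M)
            + 2 * |κ| * (|C| + |κ| + 2 * M) ^ 2) * ((1 + Real.log y) ^ 2 / y ^ 2)
      ∧ |σ y - 1 / y| ≤ 2 * (|C| + |κ| + 2 * M) * ((1 + Real.log y) / y ^ 2) := by
  -- adapted from P2 #46b `EriceFlowEnclosureInverseLawModulus.inverse_law_modulus` (a := 0, E₃ := the whole deviation, no modulus)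
  have hmem : ∀ᶠ y in atTop, σ y ∈ Ioo 0 t₁ := hσ0 (Ioo_mem_nhdsGT ht₁)
  have hlo : ∀ᶠ y in atTop, 1 / 2 < y * σ y := hone.eventually (lt_mem_nhds (by norm_num))
  have hhi : ∀ᶠ y in atTop, y * σ y < 2 := hone.eventually (gt_mem_nhds (by norm_num))
  obtain ⟨A₀, hA₀⟩ : ∃ A₀ : ℝ, A₀ = 2 * M := ⟨_, rfl⟩
  obtain ⟨B, hB⟩ : ∃ B : ℝ, B = |C| + |κ| + A₀ := ⟨_, rfl⟩
  have hA₀nn : 0 ≤ A₀ := by rw [hA₀]; positivity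
  have hB0 : 0 ≤ B := by rw [hB]; positivity
  have hsmallu : ∀ᶠ y : ℝ in atTop, B * (1 + Real.log y) / y ≤ 1 / 2 := by
    have hlogdiv : Tendsto (fun y : ℝ => Real.log y / y) atTop (𝓝 0) := Real.isLittleO_log_id_atTop.tendsto_div_nhds_zero
    have hinv : Tendsto (fun y : ℝ => 1 / y) atTop (𝓝 0) := tendsto_const_nhds.div_atTop tendsto_id
    have h : Tendsto (fun y : ℝ => B * (1 / y + Real.log y / y)) atTop (𝓝 0) := by
      have := (hinv.add hlogdiv).const_mul B; rwa [add_zero, mul_zero] at this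
    have h2 := h.eventually (gt_mem_nhds (by norm_num : (0:ℝ) < 1 / 2))
    filter_upwards [h2, eventually_gt_atTop (0:ℝ)] with y hy hy0
    have e : B * (1 + Real.log y) / y = B * (1 / y + Real.log y / y) := by field_simp
    rw [e]; exact hy.le
  filter_upwards [hmem, hσ, hlo, hhi, eventually_ge_atTop (2 : ℝ), hsmallu] with y ht he hlo hhi hy2 hsu
  set t := σ y with htdef
  have ht0 : 0 < t := ht.1
  have hy0 : 0 < y := by linarith
  have hlogy : 0 ≤ Real.log y := Real.log_nonneg (by linarith)
  obtain ⟨L, hL⟩ : ∃ L : ℝ, L = 1 + Real.log y := ⟨_, rfl⟩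
  have hL1 : 1 ≤ L := by rw [hL]; linarith
  have hL0 : 0 ≤ L := by linarith
  have hDev := hdev t ht
  rw [he] at hDev
  have ht_le : t ≤ 2 / y := by rw [le_div_iff₀ hy0]; linarith
  have ht_ge : 1 / (2 * y) ≤ t := by rw [div_le_iff₀ (by linarith)]; linarith
  have htle1 : t ≤ 1 := ht_le.trans (by rw [div_le_one hy0]; linarith)
  have hlogt : |Real.log t| ≤ Real.log y + 1 := by
    have hneg : Real.log t ≤ 0 := Real.log_nonpos ht0.le htle1
    rw [abs_of_nonpos hneg]
    have h1 : Real.log (1 / (2 * y)) ≤ Real.log t := Real.log_le_log (by positivity) ht_ge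
    rw [one_div, Real.log_inv, Real.log_mul (by norm_num) hy0.ne'] at h1
    have h2 : Real.log 2 ≤ 1 := by
      have := Real.log_le_sub_one_of_pos (by norm_num : (0:ℝ) < 2); linarith
    linarith
  -- letters E (= the deviation at t), u, r
  set E : ℝ := y - 1 / t - κ * Real.log t - C with hE
  set u : ℝ := (C + κ * Real.log t + E) / y with hu
  set r : ℝ := Real.log (y * t) - u with hr
  have hEb : |E| ≤ A₀ / y := by
    rw [hA₀]
    calc |E| ≤ M * t := by rw [hE]; exact hDev
      _ ≤ M * (2 / y) := mul_le_mul_of_nonneg_left ht_le hM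
      _ = 2 * M / y := by ring
  have hEb' : |E| ≤ A₀ := hEb.trans (by rw [div_le_iff₀ hy0]; nlinarith)
  have hub : |u| ≤ B * L / y := by
    rw [hu, abs_div, abs_of_pos hy0]
    refine div_le_div_of_nonneg_right ?_ hy0.le
    calc |C + κ * Real.log t + E| ≤ |C| + |κ * Real.log t| + |E| := abs_add_three _ _ _
      _ ≤ |C| + |κ| * (Real.log y + 1) + A₀ := by
          rw [abs_mul]; exact add_le_add (add_le_add le_rfl (mul_le_mul_of_nonneg_left hlogt (abs_nonneg _))) hEb'
      _ ≤ B * L := by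
          rw [hB, hL]; nlinarith [abs_nonneg C, abs_nonneg κ, mul_nonneg (abs_nonneg C) hlogy, mul_nonneg hA₀nn hlogy]
  have hu_half : |u| ≤ 1 / 2 := hub.trans (by rw [hL]; exact hsu)
  -- 1∕(y t) = 1 − u, log(y t) = u + r with |r| ≤ 2u²
  have hinvw : 1 / (y * t) = 1 - u := by
    have : 1 / t = y - C - κ * Real.log t - E := by simp only [hE]; ring
    rw [hu, one_div, mul_inv, ← one_div t, this]
    field_simp
    ring
  have hrb : |r| ≤ 2 * B ^ 2 * L ^ 2 / y ^ 2 := by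
    have h1 : u ^ 2 ≤ (B * L / y) ^ 2 := by
      rw [← sq_abs u]; exact pow_le_pow_left₀ (abs_nonneg _) hub 2
    calc |r| = |Real.log (y * t) - u| := by rw [hr]
      _ ≤ 2 * u ^ 2 := abs_log_sub_le_of_inv_eq hinvw hu_half
      _ ≤ 2 * (B * L / y) ^ 2 := by linarith
      _ = 2 * B ^ 2 * L ^ 2 / y ^ 2 := by rw [div_pow, mul_pow]; ring
  refine ⟨?_, ?_⟩
  · -- the exact rearrangement with the a-slot 0 and the E₃-slot E, then the three-term bound
    have hid := inverse_third_identity (κ := κ) (C := C) (a := 0) (E₃ := E) ht0 hy0 hE hu hr (by ring)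
    have hdevE : Λ (σ y) - 1 / σ y - κ * Real.log (σ y) - C = E := by rw [← htdef, he]
    have hgoal : 1 / t - y - κ * Real.log y + C - κ ^ 2 * Real.log y / y + κ * C / y + E
        = -(κ ^ 2 * (u + r) / y) - κ * E / y - κ * r - 0 * t * u - 0 := by
      have e1 : 1 / t - y - κ * Real.log y + C - κ ^ 2 * Real.log y / y + κ * C / y + E
          = (1 / t - y - κ * Real.log y + C - κ ^ 2 * Real.log y / y + (κ * C + 0) / y) + E := by ring
      rw [e1, hid]; ring
    rw [hdevE, hgoal]
    have hmain := inverse_third_remainder_le (κ := κ) (a := 0) (E₃ := 0) (A := 0) hy2 ht0 ht_le hL1 hB0 hA₀nn hub hrb hEb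
      (by rw [abs_zero]; positivity)
    refine hmain.trans (le_of_eq ?_)
    rw [hB, hA₀, hL, abs_zero]
    ring
  · -- t − 1∕y = t·u
    have htu : t - 1 / y = t * u := by
      have hyt : y * t ≠ 0 := by positivity
      have h1 : 1 = (1 - u) * (y * t) := by
        rw [← hinvw]; field_simp
      have h2 : 1 / y = (1 - u) * t := by
        field_simp
        linear_combination h1
      rw [h2]; ring
    rw [htu, abs_mul, abs_of_pos ht0]
    calc t * |u| ≤ (2 / y) * (B * L / y) := mul_le_mul ht_le hub (abs_nonneg _) (by positivity)
      _ = 2 * (|C| + |κ| + 2 * M) * ((1 + Real.log y) / y ^ 2) := by rw [hB, hA₀, hL]; ring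

/-! ## §2 A Lipschitz term is read at 1∕y -/

/-- **INVERSION CARRYING A FUNCTION TERM.**  If `|Λ t − 1∕t − κ·log t − C − F t| ≤ t·ω t` on ]0, t₁[ (t₁ > 0) with `ω ≥ 0` NON-DECREASING
on ]0, t₁[, F M-LIPSCHITZ on ]0, t₁[ with `|F t| ≤ M·t` there (M ≥ 0), and σ an eventual right inverse of Λ with `σ y → 0⁺`, `y·σ y → 1`,
then eventually
`|1∕σ y − y − κ·log y + C − κ²·(log y)∕y + κC∕y + F(1∕y)| ≤ A′·(1 + log y)²∕y² + 2·ω(2∕y)∕y`,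
A′ = κ²B + κ²B² + |κ|·2M′ + 2|κ|B² + 2MB with M′ = M + ω(t₁∕2), B = |C| + |κ| + 2M′ — F = a·t is P2 #46b `inverse_law_modulus`; here the
1∕y term of the inverse is the FUNCTION −κC∕y − F(1∕y) (§1 at t₁∕2 with deviation bound M′·t; `|F(σ y) − F(1∕y)| ≤ M·|σ y − 1∕y|`;
`|e(σ y)| ≤ σ y·ω(σ y) ≤ (2∕y)·ω(2∕y)` by monotonicity). [folklore] -/
theorem inverse_law_function {Λ σ F ω : ℝ → ℝ} {κ C M t₁ : ℝ} (hM : 0 ≤ M)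
    (hlaw : ∀ t ∈ Ioo 0 t₁, |Λ t - 1 / t - κ * Real.log t - C - F t| ≤ t * ω t)
    (hω0 : ∀ t ∈ Ioo 0 t₁, 0 ≤ ω t) (hωmono : MonotoneOn ω (Ioo 0 t₁))
    (hF0 : ∀ t ∈ Ioo 0 t₁, |F t| ≤ M * t) (hFlip : ∀ t ∈ Ioo 0 t₁, ∀ t' ∈ Ioo 0 t₁, |F t - F t'| ≤ M * |t - t'|)
    (hσ0 : Tendsto σ atTop (𝓝[>] 0)) (hσ : ∀ᶠ y in atTop, Λ (σ y) = y)
    (hone : Tendsto (fun y => y * σ y) atTop (𝓝 1)) (ht₁ : 0 < t₁) :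
    ∀ᶠ y in atTop, |1 / σ y - y - κ * Real.log y + C - κ ^ 2 * Real.log y / y + κ * C / y + F (1 / y)|
      ≤ (κ ^ 2 * (|C| + |κ| + 2 * (M + ω (t₁ / 2))) + κ ^ 2 * (|C| + |κ| + 2 * (M + ω (t₁ / 2))) ^ 2
          + |κ| * (2 * (M + ω (t₁ / 2))) + 2 * |κ| * (|C| + |κ| + 2 * (M + ω (t₁ / 2))) ^ 2
          + 2 * M * (|C| + |κ| + 2 * (M + ω (t₁ / 2)))) * ((1 + Real.log y) ^ 2 / y ^ 2)
        + 2 * ω (2 / y) / y := by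
  have ht₁2 : 0 < t₁ / 2 := by positivity
  have hmid : t₁ / 2 ∈ Ioo 0 t₁ := ⟨ht₁2, by linarith⟩
  set W : ℝ := ω (t₁ / 2) with hW
  have hW0 : 0 ≤ W := hω0 _ hmid
  -- on ]0, t₁∕2[ the deviation is ≤ (M + W)·t
  have hdev : ∀ t ∈ Ioo 0 (t₁ / 2), |Λ t - 1 / t - κ * Real.log t - C| ≤ (M + W) * t := by
    intro t ht
    have ht' : t ∈ Ioo 0 t₁ := ⟨ht.1, ht.2.trans hmid.2⟩
    have hωt : ω t ≤ W := hωmono ht' hmid ht.2.le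
    have h1 := hlaw t ht'
    have h2 := hF0 t ht'
    have h3 : |Λ t - 1 / t - κ * Real.log t - C| ≤ |Λ t - 1 / t - κ * Real.log t - C - F t| + |F t| := by
      have := abs_add_le (Λ t - 1 / t - κ * Real.log t - C - F t) (F t)
      simpa using this
    calc |Λ t - 1 / t - κ * Real.log t - C| ≤ t * ω t + M * t := h3.trans (add_le_add h1 h2)
      _ ≤ t * W + M * t := by nlinarith [ht.1]
      _ = (M + W) * t := by ring
  have hcore := inverse_law_deviation (κ := κ) (C := C) (by positivity : 0 ≤ M + W) hdev hσ0 hσ hone ht₁2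
  have hmem : ∀ᶠ y in atTop, σ y ∈ Ioo 0 t₁ := hσ0 (Ioo_mem_nhdsGT ht₁)
  have hlo : ∀ᶠ y in atTop, 1 / 2 < y * σ y := hone.eventually (lt_mem_nhds (by norm_num))
  have hhi : ∀ᶠ y in atTop, y * σ y < 2 := hone.eventually (gt_mem_nhds (by norm_num))
  have hyt₁ : ∀ᶠ y : ℝ in atTop, 4 / t₁ ≤ y := eventually_ge_atTop _
  filter_upwards [hcore, hmem, hσ, hlo, hhi, eventually_ge_atTop (2 : ℝ), hyt₁] with y hc ht he hlo hhi hy2 hy4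
  obtain ⟨hc1, hc2⟩ := hc
  set t := σ y with htdef
  have ht0 : 0 < t := ht.1
  have hy0 : 0 < y := by linarith
  have hlogy : 0 ≤ Real.log y := Real.log_nonneg (by linarith)
  set L : ℝ := 1 + Real.log y with hL
  have hL1 : 1 ≤ L := by rw [hL]; linarith
  set B : ℝ := |C| + |κ| + 2 * (M + W) with hB
  have hB0 : 0 ≤ B := by rw [hB]; positivity
  have ht_le : t ≤ 2 / y := by rw [le_div_iff₀ hy0]; linarith
  have h2y : 2 / y ≤ t₁ / 2 := by
    rw [div_le_iff₀ hy0]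
    have := (div_le_iff₀ ht₁).mp hy4
    linarith
  have h2ymem : 2 / y ∈ Ioo 0 t₁ := ⟨by positivity, by linarith⟩
  have hinvy : 1 / y ∈ Ioo 0 t₁ := ⟨by positivity, by
    have : 1 / y ≤ 2 / y := div_le_div_of_nonneg_right (by norm_num) hy0.le
    linarith⟩
  -- the deviation at t splits as F t + e t, |e t| ≤ t ω t ≤ (2∕y) ω(2∕y)
  have hωt : ω t ≤ ω (2 / y) := hωmono ht h2ymem ht_le
  have he_t : |(Λ t - 1 / t - κ * Real.log t - C) - F t| ≤ 2 * ω (2 / y) / y := by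
    calc |(Λ t - 1 / t - κ * Real.log t - C) - F t| = |Λ t - 1 / t - κ * Real.log t - C - F t| := by ring_nf
      _ ≤ t * ω t := hlaw t ht
      _ ≤ (2 / y) * ω (2 / y) := mul_le_mul ht_le hωt (hω0 t ht) (by positivity)
      _ = 2 * ω (2 / y) / y := by ring
  -- the Lipschitz transport from t = σ y to 1∕y
  have hFt : |F t - F (1 / y)| ≤ 2 * M * B * (L ^ 2 / y ^ 2) := by
    have h1 := hFlip t ht (1 / y) hinvy
    have h2 : |t - 1 / y| ≤ 2 * B * (L / y ^ 2) := by simpa only [hB, hL] using hc2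
    have hLsq : L / y ^ 2 ≤ L ^ 2 / y ^ 2 := by
      refine div_le_div_of_nonneg_right ?_ (by positivity)
      nlinarith
    calc |F t - F (1 / y)| ≤ M * |t - 1 / y| := h1
      _ ≤ M * (2 * B * (L / y ^ 2)) := mul_le_mul_of_nonneg_left h2 hM
      _ ≤ M * (2 * B * (L ^ 2 / y ^ 2)) := by
          refine mul_le_mul_of_nonneg_left (mul_le_mul_of_nonneg_left hLsq (by positivity)) hM
      _ = 2 * M * B * (L ^ 2 / y ^ 2) := by ring
  -- assemble: X + F(1∕y) = (X + D t) − (D t − F t) − (F t − F(1∕y))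
  have hsplit : |1 / t - y - κ * Real.log y + C - κ ^ 2 * Real.log y / y + κ * C / y + F (1 / y)|
      ≤ |1 / t - y - κ * Real.log y + C - κ ^ 2 * Real.log y / y + κ * C / y + (Λ t - 1 / t - κ * Real.log t - C)|
        + |(Λ t - 1 / t - κ * Real.log t - C) - F t| + |F t - F (1 / y)| := by
    have e : 1 / t - y - κ * Real.log y + C - κ ^ 2 * Real.log y / y + κ * C / y + F (1 / y)
        = (1 / t - y - κ * Real.log y + C - κ ^ 2 * Real.log y / y + κ * C / y + (Λ t - 1 / t - κ * Real.log t - C))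
          - ((Λ t - 1 / t - κ * Real.log t - C) - F t) - (F t - F (1 / y)) := by ring
    rw [e]
    exact (abs_sub _ _).trans (add_le_add (abs_sub _ _) le_rfl)
  refine hsplit.trans ?_
  have hsum := add_le_add (add_le_add hc1 he_t) hFt
  refine hsum.trans (le_of_eq ?_)
  simp only [hB, hL, hW]
  ring

/-! ## §3 The 1∕y letter of the inverse is the slope of F at 0⁺ -/

/-- **THE FUNCTION READING IS EXACT TO o(1∕y) UNDER A LITTLE-o MODULUS.**  Under the hypotheses of `inverse_law_function` and **`ω → 0` at
0⁺**: **`y·(1∕σ y − y − κ·log y + C − κ²·(log y)∕y + κC∕y + F(1∕y)) → 0`** as y → ∞ — READING (ours): `1∕g²(y) = y + κ log y − C +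
κ²(log y)∕y − κC∕y − F(1∕y) + o(1∕y)` whether or not F has a slope at 0⁺ (the majorant `A′(1 + log y)²∕y + 2ω(2∕y)` is o(1):
`(1 + log y)²∕y ≤ 16∕√y`). [folklore] -/
theorem inverse_law_function_littleO {Λ σ F ω : ℝ → ℝ} {κ C M t₁ : ℝ} (hM : 0 ≤ M)
    (hlaw : ∀ t ∈ Ioo 0 t₁, |Λ t - 1 / t - κ * Real.log t - C - F t| ≤ t * ω t)
    (hω0 : ∀ t ∈ Ioo 0 t₁, 0 ≤ ω t) (hωmono : MonotoneOn ω (Ioo 0 t₁)) (hωlim : Tendsto ω (𝓝[>] 0) (𝓝 0))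
    (hF0 : ∀ t ∈ Ioo 0 t₁, |F t| ≤ M * t) (hFlip : ∀ t ∈ Ioo 0 t₁, ∀ t' ∈ Ioo 0 t₁, |F t - F t'| ≤ M * |t - t'|)
    (hσ0 : Tendsto σ atTop (𝓝[>] 0)) (hσ : ∀ᶠ y in atTop, Λ (σ y) = y)
    (hone : Tendsto (fun y => y * σ y) atTop (𝓝 1)) (ht₁ : 0 < t₁) :
    Tendsto (fun y => y * (1 / σ y - y - κ * Real.log y + C - κ ^ 2 * Real.log y / y + κ * C / y + F (1 / y)))
      atTop (𝓝 0) := by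
  -- adapted from P2 #46b `inverse_law_littleO` (majorant A4·16∕√y + 2ω(2∕y) → 0)
  have h1 := inverse_law_function (κ := κ) (C := C) hM hlaw hω0 hωmono hF0 hFlip hσ0 hσ hone ht₁
  set W : ℝ := ω (t₁ / 2) with hW
  set A4 : ℝ := κ ^ 2 * (|C| + |κ| + 2 * (M + W)) + κ ^ 2 * (|C| + |κ| + 2 * (M + W)) ^ 2
      + |κ| * (2 * (M + W)) + 2 * |κ| * (|C| + |κ| + 2 * (M + W)) ^ 2 + 2 * M * (|C| + |κ| + 2 * (M + W)) with hA4
  have hW0 : 0 ≤ W := hω0 _ ⟨by positivity, by linarith⟩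
  have hA40 : 0 ≤ A4 := by positivity
  have h2y : Tendsto (fun y : ℝ => 2 / y) atTop (𝓝[>] 0) := by
    refine tendsto_nhdsWithin_iff.mpr ⟨tendsto_const_nhds.div_atTop tendsto_id, ?_⟩
    filter_upwards [eventually_gt_atTop (0 : ℝ)] with y hy
    exact div_pos two_pos hy
  have hω2 : Tendsto (fun y : ℝ => ω (2 / y)) atTop (𝓝 0) := hωlim.comp h2y
  have hsq : Tendsto (fun y : ℝ => A4 * (16 * (Real.sqrt y)⁻¹)) atTop (𝓝 0) := by
    have h := (tendsto_inv_atTop_zero.comp Real.tendsto_sqrt_atTop).const_mul 16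
    have h' := h.const_mul A4
    simpa using h'
  have hmaj : Tendsto (fun y : ℝ => A4 * (16 * (Real.sqrt y)⁻¹) + 2 * ω (2 / y)) atTop (𝓝 0) := by
    have := hsq.add (hω2.const_mul 2)
    rwa [mul_zero, add_zero] at this
  refine squeeze_zero_norm' ?_ hmaj
  filter_upwards [h1, eventually_ge_atTop (1 : ℝ)] with y hy hy1
  have hy0 : 0 < y := by linarith
  have hsy : 0 < Real.sqrt y := Real.sqrt_pos.mpr hy0
  rw [norm_mul, Real.norm_eq_abs, Real.norm_eq_abs, abs_of_pos hy0]
  have hL2 : (1 + Real.log y) ^ 2 / y ^ 2 ≤ 16 / (y * Real.sqrt y) := logSq_div_sq_le_inv_sqrt hy1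
  calc y * |1 / σ y - y - κ * Real.log y + C - κ ^ 2 * Real.log y / y + κ * C / y + F (1 / y)|
      ≤ y * (A4 * ((1 + Real.log y) ^ 2 / y ^ 2) + 2 * ω (2 / y) / y) := mul_le_mul_of_nonneg_left hy hy0.le
    _ ≤ y * (A4 * (16 / (y * Real.sqrt y)) + 2 * ω (2 / y) / y) := by
        refine mul_le_mul_of_nonneg_left (add_le_add (mul_le_mul_of_nonneg_left hL2 hA40) le_rfl) hy0.le
    _ = A4 * (16 * (Real.sqrt y)⁻¹) + 2 * ω (2 / y) := by field_simp

/-- **THE 1∕y LETTER IS THE SLOPE OF THE FUNCTION TERM (both directions).**  Under the hypotheses of `inverse_law_function` and **`ω → 0`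
at 0⁺**, for every b:
**`y·(1∕σ y − y − κ·log y + C − κ²·(log y)∕y + (κC + b)∕y) → 0` as y → ∞   ⟺   `F(t)∕t → b` as t → 0⁺**
— READING (ours): the running coupling has the 1∕y letter −(κC + b) iff Λ's function term has the slope b at 0⁺
(`inverse_law_function_littleO`, and `y·F(1∕y) → b ⟺ F(t)∕t → b`, §0). [folklore] -/
theorem invY_letter_iff_slope {Λ σ F ω : ℝ → ℝ} {κ C M t₁ : ℝ} (hM : 0 ≤ M)
    (hlaw : ∀ t ∈ Ioo 0 t₁, |Λ t - 1 / t - κ * Real.log t - C - F t| ≤ t * ω t)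
    (hω0 : ∀ t ∈ Ioo 0 t₁, 0 ≤ ω t) (hωmono : MonotoneOn ω (Ioo 0 t₁)) (hωlim : Tendsto ω (𝓝[>] 0) (𝓝 0))
    (hF0 : ∀ t ∈ Ioo 0 t₁, |F t| ≤ M * t) (hFlip : ∀ t ∈ Ioo 0 t₁, ∀ t' ∈ Ioo 0 t₁, |F t - F t'| ≤ M * |t - t'|)
    (hσ0 : Tendsto σ atTop (𝓝[>] 0)) (hσ : ∀ᶠ y in atTop, Λ (σ y) = y)
    (hone : Tendsto (fun y => y * σ y) atTop (𝓝 1)) (ht₁ : 0 < t₁) (b : ℝ) :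
    Tendsto (fun y => y * (1 / σ y - y - κ * Real.log y + C - κ ^ 2 * Real.log y / y + (κ * C + b) / y)) atTop (𝓝 0) ↔
      Tendsto (fun t => F t / t) (𝓝[>] 0) (𝓝 b) := by
  have hG := inverse_law_function_littleO (κ := κ) (C := C) hM hlaw hω0 hωmono hωlim hF0 hFlip hσ0 hσ hone ht₁
  -- y·(bracket with b) = y·G y − (y·F(1∕y) − b), G y the bracket of `inverse_law_function_littleO`
  have hrel : ∀ᶠ y in atTop, y * (1 / σ y - y - κ * Real.log y + C - κ ^ 2 * Real.log y / y + (κ * C + b) / y)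
      = y * (1 / σ y - y - κ * Real.log y + C - κ ^ 2 * Real.log y / y + κ * C / y + F (1 / y))
        - (y * F (1 / y) - b) := by
    filter_upwards [eventually_gt_atTop (0 : ℝ)] with y hy
    field_simp
    ring
  rw [← tendsto_mul_comp_inv_iff]
  constructor
  · intro h
    have h2 := hG.sub (h.congr' hrel)
    rw [sub_zero] at h2
    have h3 := h2.add_const b
    rw [zero_add] at h3
    exact h3.congr fun y => by ring
  · intro h
    have h2 := hG.sub (h.sub_const b)
    rw [sub_self, sub_zero] at h2
    exact h2.congr' (by filter_upwards [hrel] with y hy; rw [hy])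

/-- **A SLOPE GIVES THE LETTER** (the ⟸ half of `invY_letter_iff_slope`, displayed): `F(t)∕t → b` at 0⁺ ⟹
`y·(1∕σ y − y − κ·log y + C − κ²·(log y)∕y + (κC + b)∕y) → 0`. [folklore] -/
theorem invY_letter_of_slope {Λ σ F ω : ℝ → ℝ} {κ C M t₁ : ℝ} (hM : 0 ≤ M)
    (hlaw : ∀ t ∈ Ioo 0 t₁, |Λ t - 1 / t - κ * Real.log t - C - F t| ≤ t * ω t)
    (hω0 : ∀ t ∈ Ioo 0 t₁, 0 ≤ ω t) (hωmono : MonotoneOn ω (Ioo 0 t₁)) (hωlim : Tendsto ω (𝓝[>] 0) (𝓝 0))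
    (hF0 : ∀ t ∈ Ioo 0 t₁, |F t| ≤ M * t) (hFlip : ∀ t ∈ Ioo 0 t₁, ∀ t' ∈ Ioo 0 t₁, |F t - F t'| ≤ M * |t - t'|)
    (hσ0 : Tendsto σ atTop (𝓝[>] 0)) (hσ : ∀ᶠ y in atTop, Λ (σ y) = y)
    (hone : Tendsto (fun y => y * σ y) atTop (𝓝 1)) (ht₁ : 0 < t₁) {b : ℝ}
    (hslope : Tendsto (fun t => F t / t) (𝓝[>] 0) (𝓝 b)) :
    Tendsto (fun y => y * (1 / σ y - y - κ * Real.log y + C - κ ^ 2 * Real.log y / y + (κ * C + b) / y)) atTop (𝓝 0) :=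
  (invY_letter_iff_slope hM hlaw hω0 hωmono hωlim hF0 hFlip hσ0 hσ hone ht₁ b).mpr hslope

end

end Summit.QuantumFields.BalabanUV.Beta.EriceFlowEnclosureInverseLawFunction
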